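import Summits.QuantumFields.YangMills.Theorems.PencilRigidityWeakCouplingHypercubicLimitRPBudgetDecay
import Summits.QuantumFields.YangMills.Theorems.DiagonalMirrorRPRDiagonalSliceModelSlowMode
import Summits.QuantumFields.YangMills.Theorems.DiagonalMirrorRPRTwoShiftNormalisation

/-!
# Crux `WeakCouplingHypercubicLimitRP` (stmt-QuantumFields-27398), door B, R1-side, sandwich side item (iv-c):
# THE INSTANCE `twoShiftProbesAt` — the pinned two-shift probe of the model of record, PARAMETRIC in item (ii)'s identities

Helper file (`--supports stmt-QuantumFields-27398 --as helper`) of hand `hand-10604-wilsonDiagModel-3` g0, docket director-ym g24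
**O4 WORD 47 (1)/(3), WORD 48 (2)–(4), WORD 49 (3)** (target of record: `twoShiftProbesAt … : TwoShiftProbes (wilsonDiagonalTransferModel r sch hβ)`
with every field DEFINED and `PinnedTo P C`; p-W1 «PIN THE PROBE» of verdict #119, accounting of record «PAID MODULO ONE DISPLAYED LETTER»).

Division of labour (WORD 48 (2)): item (ii) — the YM identification of the lead's `swapShiftPairing` with the two-insertion cyclic chain of
the slice transfer operator (hand `hand-10604-wilsonDiagModel-2` g3) — delivers, per step `k`, two `HasSum` identities in the EIGEN currency of
`slicePkgAt r sch hβ k`; this file is written PARAMETRICALLY in that output, so that neither hand guesses the other's conventions: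

* §1 `TwoShiftIdentities r sch hβ P` — EXACTLY what (ii) must hand over for a pinned probe `P : PinnedProbe sch`: naturals `N_k, d_k`, a
  normaliser `Z_k > 0`, non-negative summable two-index weights `w_k(a,b)` on the eigen-index of `slicePkgAt r sch hβ k`, the probe-shift
  side conditions (`n_k ≠ 0`, `side_k ≤ 16 n_k`, `6n_k + 2d_k ≤ N_k`, `3 side_k ≤ 8 (N_k − 6n_k − 2d_k)` eventually), and the two identities
  `HasSum (p ↦ w_k p.1 p.2 · κ_{p.2}^{2m} · κ_{p.1}^{N_k−2m−2d_k}) (Z_k · swapShiftPairing r sch (P.Y k) m k)` for `m = n_k` and `m = 2n_k`, eventually;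
* §2 `vacuumEig r sch hβ k h3` — a chosen vacuum eigen-index (✓`exists_vacuumEig`: padded to `topIdx`, eigenvalue `= top_k > 0`);
  `TwoShiftIdentities.visRaw I k := (top_k^{N−2d}/Z_k) · Σ'_{b ≠ o_k, |κ_b| = r_k·top_k} w_k(o_k, b)` (`∝ ‖P_{Slow_k} 𝒲 ψ_vac‖²`, the visible weight on the
  slowest eigenspace; `0` below `side_k = 3`), `TwoShiftIdentities.offTop I k := (top_k^{N−2d}/Z_k) · Σ'_{p.1 ≠ o_k} w_k p`; both `≥ 0`;
* §3 ★ the displayed coupling letter `SlowCoupled I : Prop := ∀ᶠ k, 0 < visRaw I k` (WORD 48 (4) OPTION A; booked on wall W-45-vis beside K2 — the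
  pinned local probe SEES the slowest mode), and ★★ `twoShiftProbesAt I C hC hc : TwoShiftProbes (wilsonDiagonalTransferModel r sch hβ)` with
  `r := slowRatio`, `j₀ := topIdx` (✓`…DiagonalSliceModelSlowMode`, spectral readings for ALL `k`), `n := P.n`, `p := N − 6n − 2d`,
  `vis := visRaw` where positive (junk `1` at the finitely many other `k` under `hc`), `W := offTop`, `scale := probeVariance + C·B²`,
  `budget := |P_{n} − P_{2n}|` — every field DEFINED; `signal` PROVED (✓`signal_of_twoShift_hasSum` on the positive branch, `r^{N−4n−2d} = r^{p} r^{2n}`);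
  `twoShiftProbesAt_pinnedTo : (twoShiftProbesAt I C hC hc).PinnedTo P C` by `rfl`s — so ✓`budgetDecay_of_diagCluster` /
  ✓`oddTwistGap_of_rpSpectral_of_twoShiftLetters` apply to it verbatim (§4 `budgetDecay_twoShiftProbesAt`; the composition to R1 / D1′ by name is the separate composition file).

CAVEAT (WORD 48 (4), recorded so that nobody sells it later): on the junk branch (`visRaw I k ≤ 0`, finitely many `k` under `hc`) the field
`vis k = 1` carries NO coupling information, so K2 `SlowestVisible` read at such `k` is not a visibility statement; all letters are `∀ᶠ` and
the junk branch is invisible to them exactly because `hc` holds.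

HONEST FRAMING: plumbing — a structure recording (ii)'s owed identities, explicit formulas, and one real-analysis composition.  `SlowCoupled`,
the identities' content (item (ii)), K1 `CoarseGap ∧ JunkVisible`, K2 `SlowestVisible`, the AXIS letter `RPSpectral`, R2/R2♭ are NOT proved
here; nothing about Wilson's measure at weak coupling is proved; D1′, the crux ⟨27398⟩, its heart S6i and the summit are OPEN; the Yang–Mills mass
gap is NOT proved here or anywhere in the tree.  No instance, no notation, `autoImplicit false`.

References: Fröhlich–Israel–Lieb–Simon, CMP 62 (1978) Thm 2.1; Osterwalder–Seiler, Ann. Phys. 110 (1978) §2–3; B. Simon, *Trace Ideals* (2005) Ch. 3.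
-/

set_option autoImplicit false

noncomputable section

open MeasureTheory Filter Topology
open Literature.MathematicalPhysics.QuantumLattice Literature.MathematicalPhysics.AQFT
  Literature.MathematicalPhysics.QuantumFieldTheory
open Summit.QuantumFields.YangMills.Cruxes.HypercubicLimit.CouplingResponse (RPSpectral)
open Summit.QuantumFields.YangMills.Cruxes.DiagonalMirrorRPR.SignTwistedDiagonalTrace
open Summit.QuantumFields.YangMills.Cruxes.DiagonalMirrorRPR.SignTwistedDiagonalTrace.WilsonDiagonal

namespace Summit.QuantumFields.YangMills.Cruxes.DiagonalMirrorRPR.SpectralTransfer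

variable {G : Type} [Group G] [TopologicalSpace G] [IsTopologicalGroup G] [CompactSpace G]
  [MeasurableSpace G] [BorelSpace G] (r : LatticeRep G) (sch : SpeciesScheme (YMSpecies G))

/-! ## §1 What item (ii) hands over: the two-insertion identities in the eigen currency -/

/-- **The two-shift identities of a pinned probe in the eigen currency of the model of record** — the OUTPUT SHAPE of item (ii) (the YM
identification of `swapShiftPairing` with the two-insertion cyclic chain of the slice transfer operator, ✓`hasSum_integral_iterate_insert_two`):
per step `k`, on the eigen-package `slicePkgAt r sch hβ k` (eigenvalues `κ`), naturals `N_k` (long-leg budget), `d_k` (layers spent per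
insertion), a normaliser `Z_k > 0` (e.g. `Tr 𝔄_k^{side_k}`), non-negative summable two-index weights `w_k(a,b)` (`= ⟪ψ_a, 𝒲 ψ_b⟫⟪ψ_b, 𝒲ᵀ ψ_a⟫`,
Hilbert–Schmidt), the probe-shift side conditions, and the two identities at the shifts `n_k`, `2n_k` (short leg `2m` layers per diagonal shift `m`;
extra FIXED even powers are to be folded into `w`, extra fixed long-leg powers into `N`/`d` — only these two shapes are consumed). -/
structure TwoShiftIdentities (hβ : ∀ k, 0 ≤ sch.β k) (P : PinnedProbe sch) where
  /-- long-leg budget and layers spent per insertion -/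
  N : ℕ → ℕ
  d : ℕ → ℕ
  /-- the normaliser (partition function) -/
  Z : ℕ → ℝ
  Z_pos : ∀ k, 0 < Z k
  /-- the two-index weights on the eigen-index of `slicePkgAt r sch hβ k` -/
  w : (k : ℕ) → (slicePkgAt r sch hβ k).s → (slicePkgAt r sch hβ k).s → ℝ
  w_nonneg : ∀ k a b, 0 ≤ w k a b
  w_summable : ∀ k, Summable fun p : (slicePkgAt r sch hβ k).s × (slicePkgAt r sch hβ k).s => w k p.1 p.2
  /-- probe-shift side conditions (fields `n_pos`, `n_ge`, `p_ge` of `TwoShiftProbes` with `p := N − 6n − 2d`) -/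
  n_pos : ∀ k, P.n k ≠ 0
  n_ge : ∀ᶠ k in atTop, (sch.side k : ℝ) ≤ 16 * P.n k
  le_N : ∀ᶠ k in atTop, 6 * P.n k + 2 * d k ≤ N k
  p_ge : ∀ᶠ k in atTop, 3 * (sch.side k : ℝ) ≤ 8 * ((N k - 6 * P.n k - 2 * d k : ℕ) : ℝ)
  /-- the identity at the shift `n_k`: `Σ w(a,b) κ_b^{2n} κ_a^{N−2n−2d} = Z · P_{n}` -/
  ident₁ : ∀ᶠ k in atTop,
    HasSum (fun p : (slicePkgAt r sch hβ k).s × (slicePkgAt r sch hβ k).s =>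
        w k p.1 p.2 * ((slicePkgAt r sch hβ k).κ p.2 ^ (2 * P.n k) *
          (slicePkgAt r sch hβ k).κ p.1 ^ (N k - 2 * P.n k - 2 * d k)))
      (Z k * swapShiftPairing r sch (P.Y k) (P.n k) k)
  /-- the identity at the shift `2n_k`: `Σ w(a,b) κ_b^{4n} κ_a^{N−4n−2d} = Z · P_{2n}` -/
  ident₂ : ∀ᶠ k in atTop,
    HasSum (fun p : (slicePkgAt r sch hβ k).s × (slicePkgAt r sch hβ k).s =>
        w k p.1 p.2 * ((slicePkgAt r sch hβ k).κ p.2 ^ (2 * (2 * P.n k)) *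
          (slicePkgAt r sch hβ k).κ p.1 ^ (N k - 2 * (2 * P.n k) - 2 * d k)))
      (Z k * swapShiftPairing r sch (P.Y k) (2 * P.n k) k)

/-! ## §2 The vacuum eigen-index; visible and off-top weights -/

/-- **A chosen vacuum eigen-index** of `slicePkgAt r sch hβ k` at an index with `side_k ≥ 3` (✓`exists_vacuumEig`). -/
def vacuumEig (hβ : ∀ k, 0 ≤ sch.β k) (k : ℕ) (h3 : 3 ≤ sch.side k) : (slicePkgAt r sch hβ k).s :=
  Classical.choose (exists_vacuumEig r sch hβ k h3)

/-- The vacuum eigen-index is padded to the vacuum index `topIdx` of the model of record. -/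
theorem emb_vacuumEig (hβ : ∀ k, 0 ≤ sch.β k) (k : ℕ) (h3 : 3 ≤ sch.side k) :
    (slicePkgAt r sch hβ k).emb (vacuumEig r sch hβ k h3) = (wilsonDiagonalTransferModel r sch hβ).topIdx k :=
  (Classical.choose_spec (exists_vacuumEig r sch hβ k h3)).1

/-- The vacuum eigenvalue IS the top modulus: `κ o_k = top_k`. -/
theorem kappa_vacuumEig (hβ : ∀ k, 0 ≤ sch.β k) (k : ℕ) (h3 : 3 ≤ sch.side k) :
    (slicePkgAt r sch hβ k).κ (vacuumEig r sch hβ k h3) = (wilsonDiagonalTransferModel r sch hβ).top k :=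
  (Classical.choose_spec (exists_vacuumEig r sch hβ k h3)).2

/-- Off the vacuum eigen-index every eigenvalue modulus is `≤ slowRatio_k · top_k`. -/
theorem abs_kappa_le_of_ne_vacuumEig (hβ : ∀ k, 0 ≤ sch.β k) (k : ℕ) (h3 : 3 ≤ sch.side k) (a : (slicePkgAt r sch hβ k).s)
    (ha : a ≠ vacuumEig r sch hβ k h3) :
    |(slicePkgAt r sch hβ k).κ a| ≤
      (wilsonDiagonalTransferModel r sch hβ).slowRatio k * (wilsonDiagonalTransferModel r sch hβ).top k := by
  refine abs_kappa_le_slowRatio_mul_top r sch hβ k h3 a fun h => ha ?_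
  rw [← emb_vacuumEig r sch hβ k h3] at h
  exact (slicePkgAt r sch hβ k).emb_injective h

variable {r sch} {hβ : ∀ k, 0 ≤ sch.β k} {P : PinnedProbe sch}

namespace TwoShiftIdentities

/-- **The visible weight on the slowest eigenspace** (raw): `(top_k^{N−2d}/Z_k) · Σ'_{b ≠ o_k, |κ_b| = r_k·top_k} w_k(o_k, b)`
(`∝ ‖P_{Slow_k} 𝒲 ψ_vac‖²`, basis-free); `0` at the finitely many indices with `side_k < 3`. -/
def visRaw (I : TwoShiftIdentities r sch hβ P) (k : ℕ) : ℝ :=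
  if h3 : 3 ≤ sch.side k then
    (wilsonDiagonalTransferModel r sch hβ).top k ^ (I.N k - 2 * I.d k) / I.Z k *
      ∑' b : {b : (slicePkgAt r sch hβ k).s | b ≠ vacuumEig r sch hβ k h3 ∧
          |(slicePkgAt r sch hβ k).κ b| =
            (wilsonDiagonalTransferModel r sch hβ).slowRatio k * (wilsonDiagonalTransferModel r sch hβ).top k},
        I.w k (vacuumEig r sch hβ k h3) b
  else 0

/-- **The off-top total weight**: `(top_k^{N−2d}/Z_k) · Σ'_{p.1 ≠ o_k} w_k p`; `0` below `side_k = 3`. -/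
def offTop (I : TwoShiftIdentities r sch hβ P) (k : ℕ) : ℝ :=
  if h3 : 3 ≤ sch.side k then
    (wilsonDiagonalTransferModel r sch hβ).top k ^ (I.N k - 2 * I.d k) / I.Z k *
      ∑' p : {p : (slicePkgAt r sch hβ k).s × (slicePkgAt r sch hβ k).s | p.1 ≠ vacuumEig r sch hβ k h3},
        I.w k p.1.1 p.1.2
  else 0

/-- `0 ≤ visRaw I k`. -/
theorem visRaw_nonneg (I : TwoShiftIdentities r sch hβ P) (k : ℕ) : 0 ≤ I.visRaw k := by
  unfold visRaw
  split_ifs with h3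
  · exact mul_nonneg (div_nonneg (pow_nonneg ((wilsonDiagonalTransferModel r sch hβ).top_pos k).le _) (I.Z_pos k).le)
      (tsum_nonneg fun b => I.w_nonneg k _ _)
  · exact le_rfl

/-- `0 ≤ offTop I k` (the field `W_nonneg`). -/
theorem offTop_nonneg (I : TwoShiftIdentities r sch hβ P) (k : ℕ) : 0 ≤ I.offTop k := by
  unfold offTop
  split_ifs with h3
  · exact mul_nonneg (div_nonneg (pow_nonneg ((wilsonDiagonalTransferModel r sch hβ).top_pos k).le _) (I.Z_pos k).le)
      (tsum_nonneg fun p => I.w_nonneg k _ _)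
  · exact le_rfl

end TwoShiftIdentities

/-- **Variances are non-negative on the pinned probe**: `0 ≤ probeVariance r sch (P.Y k) k` (✓`sq_integral_le_integral_sq`). -/
theorem probeVariance_nonneg (P : PinnedProbe sch) (k : ℕ) : 0 ≤ probeVariance r sch (P.Y k) k := by
  unfold probeVariance
  exact sub_nonneg.2 (sq_integral_le_integral_sq r.ρ r.continuous (sch.β k) (2 * sch.L k + 1) (P.measurable k) (P.bdd k))

/-! ## §3 The displayed coupling letter and the instance -/

/-- ★ **LETTER `SlowCoupled I`** (the displayed coupling letter of O4 WORD 48 (4), OPTION A; wall W-45-vis beside K2): eventually the pinned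
probe COUPLES the vacuum to the slowest eigenspace of the slice transfer operator — `0 < visRaw I k`, i.e. `Σ'_{b ∈ Slow_k} w_k(o_k, b) > 0`
(`∝ ‖P_{Slow_k} 𝒲_{Y_k} ψ_vac‖² > 0`).  Physics of the probe (a probe in the wrong symmetry sector is blind); NOT proved here.  The road that
would retire it — «local box observables separate the modes ⇒ ∃ pinned `P`, SlowCoupled» — is an (ii)-level density statement, not commissioned. -/
def SlowCoupled (I : TwoShiftIdentities r sch hβ P) : Prop :=
  ∀ᶠ k in atTop, 0 < I.visRaw k

/-- ★★ **THE INSTANCE: the pinned two-shift probe of the model of record.**  Every field DEFINED: `r := slowRatio`, `j₀ := topIdx`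
(spectral readings for ALL `k`, ✓`…DiagonalSliceModelSlowMode`), `n := P.n`, `p := N − 6n − 2d`, `vis := visRaw I` where positive (junk `1` at
the finitely many other indices under `hc` — CAVEAT: there `vis` carries no coupling information and K2 read at such `k` is not a visibility
statement), `W := offTop I`, `scale := probeVariance + C·B²`, `budget := |P_{n} − P_{2n}|`; `signal` PROVED from (ii)'s identities by
✓`signal_of_twoShift_hasSum`. -/
def twoShiftProbesAt (I : TwoShiftIdentities r sch hβ P) (C : ℝ) (hC : 0 ≤ C) (hc : SlowCoupled I) :
    TwoShiftProbes (wilsonDiagonalTransferModel r sch hβ) where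
  r := (wilsonDiagonalTransferModel r sch hβ).slowRatio
  j₀ := (wilsonDiagonalTransferModel r sch hβ).topIdx
  n := P.n
  p k := I.N k - 6 * P.n k - 2 * I.d k
  vis k := if 0 < I.visRaw k then I.visRaw k else 1
  W := I.offTop
  scale k := probeVariance r sch (P.Y k) k + C * P.B k ^ 2
  budget k := |swapShiftPairing r sch (P.Y k) (P.n k) k - swapShiftPairing r sch (P.Y k) (2 * P.n k) k|
  r_nonneg := (wilsonDiagonalTransferModel r sch hβ).slowRatio_nonneg
  r_le_one := (wilsonDiagonalTransferModel r sch hβ).slowRatio_le_one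
  r_spec_odd := Eventually.of_forall fun k j => (wilsonDiagonalTransferModel r sch hβ).sm_le_slowRatio_mul_top k j
  r_spec_even := Eventually.of_forall fun k _ hj => (wilsonDiagonalTransferModel r sch hβ).sp_le_slowRatio_mul_top k hj
  n_pos := I.n_pos
  n_ge := I.n_ge
  p_ge := I.p_ge
  vis_pos k := by
    by_cases h : 0 < I.visRaw k
    · rw [if_pos h]; exact h
    · rw [if_neg h]; exact one_pos
  W_nonneg := I.offTop_nonneg
  scale_nonneg k := add_nonneg (probeVariance_nonneg P k) (mul_nonneg hC (sq_nonneg _))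
  signal := by
    filter_upwards [hc, I.le_N, I.ident₁, I.ident₂, eventually_three_le_side sch] with k hck hN h₁ h₂ h3
    rw [if_pos hck]
    have hvis : I.visRaw k = (wilsonDiagonalTransferModel r sch hβ).top k ^ (I.N k - 2 * I.d k) / I.Z k *
        ∑' b : {b : (slicePkgAt r sch hβ k).s | b ≠ vacuumEig r sch hβ k h3 ∧
          |(slicePkgAt r sch hβ k).κ b| =
            (wilsonDiagonalTransferModel r sch hβ).slowRatio k * (wilsonDiagonalTransferModel r sch hβ).top k},
        I.w k (vacuumEig r sch hβ k h3) b := by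
      unfold TwoShiftIdentities.visRaw; rw [dif_pos h3]
    have hoff : I.offTop k = (wilsonDiagonalTransferModel r sch hβ).top k ^ (I.N k - 2 * I.d k) / I.Z k *
        ∑' p : {p : (slicePkgAt r sch hβ k).s × (slicePkgAt r sch hβ k).s | p.1 ≠ vacuumEig r sch hβ k h3},
          I.w k p.1.1 p.1.2 := by
      unfold TwoShiftIdentities.offTop; rw [dif_pos h3]
    have hmain := signal_of_twoShift_hasSum (slicePkgAt r sch hβ k).κ ((wilsonDiagonalTransferModel r sch hβ).top_pos k)
      (abs_kappa_le_top r sch hβ k h3) (vacuumEig r sch hβ k h3) (kappa_vacuumEig r sch hβ k h3) (I.w k) (I.w_nonneg k)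
      (I.w_summable k) (I.Z_pos k) (I.N k) (I.d k) (P.n k) (by omega) h₁ h₂
      ((wilsonDiagonalTransferModel r sch hβ).slowRatio_nonneg k)
      (fun a ha => abs_kappa_le_of_ne_vacuumEig r sch hβ k h3 a ha)
    have hpow : (wilsonDiagonalTransferModel r sch hβ).slowRatio k ^ (I.N k - 4 * P.n k - 2 * I.d k) =
        (wilsonDiagonalTransferModel r sch hβ).slowRatio k ^ (I.N k - 6 * P.n k - 2 * I.d k) *
          (wilsonDiagonalTransferModel r sch hβ).slowRatio k ^ (2 * P.n k) := by
      rw [← pow_add]; congr 1; omega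
    rw [hvis, hoff]
    rw [hpow] at hmain
    have habs := le_abs_self (swapShiftPairing r sch (P.Y k) (P.n k) k - swapShiftPairing r sch (P.Y k) (2 * P.n k) k)
    nlinarith [hmain, habs]

/-- **The instance is pinned to `P` with thermal constant `C`** (`n`, `budget`, `scale` read off the probe — by `rfl`). -/
theorem twoShiftProbesAt_pinnedTo (I : TwoShiftIdentities r sch hβ P) (C : ℝ) (hC : 0 ≤ C) (hc : SlowCoupled I) :
    (twoShiftProbesAt I C hC hc).PinnedTo P C :=
  ⟨fun _ => rfl, fun _ => rfl, fun _ => rfl⟩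

/-- The instance's `vis` agrees with `visRaw` eventually (under the coupling letter). -/
theorem twoShiftProbesAt_vis_eventually (I : TwoShiftIdentities r sch hβ P) (C : ℝ) (hC : 0 ≤ C) (hc : SlowCoupled I) :
    ∀ᶠ k in atTop, (twoShiftProbesAt I C hC hc).vis k = I.visRaw k := by
  filter_upwards [hc] with k hk
  show (if 0 < I.visRaw k then I.visRaw k else 1) = I.visRaw k
  rw [if_pos hk]

/-- The instance's fields by name: `r = slowRatio`, `j₀ = topIdx`, `W = offTop`, `p k = N − 6n − 2d`. -/
theorem twoShiftProbesAt_r (I : TwoShiftIdentities r sch hβ P) (C : ℝ) (hC : 0 ≤ C) (hc : SlowCoupled I) :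
    (twoShiftProbesAt I C hC hc).r = (wilsonDiagonalTransferModel r sch hβ).slowRatio ∧
      (twoShiftProbesAt I C hC hc).j₀ = (wilsonDiagonalTransferModel r sch hβ).topIdx ∧
      (twoShiftProbesAt I C hC hc).W = I.offTop ∧
      (∀ k, (twoShiftProbesAt I C hC hc).p k = I.N k - 6 * P.n k - 2 * I.d k) :=
  ⟨rfl, rfl, rfl, fun _ => rfl⟩

/-! ## §4 K3 on the instance, by name -/

/-- **K3 `BudgetDecay` holds for the instance** from `DiagCluster r sch Δ C` (✓`budgetDecay_of_diagCluster` on `twoShiftProbesAt_pinnedTo`, verbatim),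
hence from the AXIS letter `RPSpectral r sch Δ C` (✓`budgetDecay_of_rpSpectral`).  The composition to R1 / D1′ by name is the separate composition
file (O4 WORD 49 (3) / 50 (4)). [cite: FrohlichIsraelLiebSimon1978, Thm. 2.1] -/
theorem budgetDecay_twoShiftProbesAt (I : TwoShiftIdentities r sch hβ P) {Δ C : ℝ} (hΔ : 0 ≤ Δ) (hC : 0 ≤ C) (hc : SlowCoupled I)
    (hRP : RPSpectral r sch Δ C) : BudgetDecay (twoShiftProbesAt I C hC hc) Δ :=
  budgetDecay_of_rpSpectral (twoShiftProbesAt I C hC hc) P (twoShiftProbesAt_pinnedTo I C hC hc) hΔ hC (Eventually.of_forall hβ) hRP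

end Summit.QuantumFields.YangMills.Cruxes.DiagonalMirrorRPR.SpectralTransfer

end
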